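import Summits.NavierStokesRegularity.NavierStokesRegularity.Theorems.ScenarioCensusRowF1ax
import Summits.NavierStokesRegularity.NavierStokesRegularity.Theorems.ScenarioCensusRowA7h
import Summits.NavierStokesRegularity.NavierStokesRegularity.Theorems.DssFarFieldSlavingBlowupTypeIDssProfileSimilarityEnstrophyBeltramiLiouville
import Literature.Analysis.FluidPDE.BarkerPrange2020VorticityAlignmentTypeIHolds
import HarnessLib
import Summits.NavierStokesRegularity.NavierStokesRegularity.Theorems.ScenarioCensusRowF1StretchedTransfer

/-!
# Census row F1, family «ε-TOPS» (F1qd / F1qa / F1qw / F1ql: the ε(M)-form upgrade of the columnar / vorticity-axis / sub-Type-I-vorticity / Lamb tops) — LINE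
# «epsilon-top» port, part 1/4: the dimensionless Type-I constant, ε-defects on the top, the rows, the floor `QuantitativelyThreeDTop`, the residual
# `VorticityDefectSlack` (§1); the `M`-normalised singular Type-I zoom package with gradients (§2)

Re-homed for the scenario census (typer seat ns-census-typer-1 g8; the cells F1qd / F1qa / F1qw / F1ql are MEMBERS OF RECORD «DECIDED IN KERNEL IN FILES» of row F1
since census v1.69 (lead g9 RULING [6]; critic idea-crit-3 g6 PASS; ref ns-census-ref g8 PRE-CHECK ✓ §13.14; lit §21.21); this port makes them TREE-decided):
VERBATIM PORT of ns-idea-3 LINE 17 «epsilon-top», `pub/ideators/ns-idea-3/lines/epsilon-top/line-epsilon-top.lean` sha16 1627485ff09d51d4 (1185 l., lean check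
rc 0, 0 sorry), split for the 400-line rule into `ScenarioCensusRowF1Epsilon` (§1–§2) → `…EpsilonLiouville` (§3) → `…EpsilonTransfer` (§4) → `…EpsilonTop` (§5 +
census KEYS).  Lean text VERBATIM in namespace `…Theorems.ScenarioCensus.EpsilonTop` (the line's `…Cruxes.ScenarioCensusRowF1.EpsilonTopLine` re-homed); port
edits: `@[conjecture]` on the residual `VorticityDefectSlack` (≡ `ScenarioCensus.Row_F1`, OPEN), three one-line docstrings added (gate lint); the import of `Theorems.ClockStretchingLawClockCeilingFarPastVorticityFloor` and the ONE display that uses it (`liouville_qw_of_farPastVorticityFloor`, a second proof of `Liouville_qw` from the tree's far-past vorticity floor) are dropped because that module has no farm build at port time — `liouville_qw_holds` is the line's own proof and stays; the lemmas (and the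
read-out `axialDefect`) the line shares VERBATIM with the landed columnar-top / stretched-top / inviscid-top ports are taken BY NAME (listed below).
Statements untouched.

No census VALUE is moved here (row F1 stays OPEN-WITH-LINE; the members become TREE-decided by name); NS regularity is NOT proved; `Row_F1` is
untouched (zero movement, `vorticityDefectSlack_iff_rowF1`); no summit statement is proved by this file. Lemmas that restate already-landed tree declarations are taken BY NAME (gate lint `dedup.landed`): `norm_sub_inner_smul_le` = `ColumnarTop.norm_sub_inner_smul_le`, `exists_linearIsometryEquiv_map_single_one` = `ColumnarTop.exists_linearIsometryEquiv_map_single_one`, `eq_zero_of_lineInvariant` = `ColumnarTop.eq_zero_of_lineInvariant`, `isOpen_ne_zero` = `ColumnarTop.isOpen_ne_zero`, `curl_zero_field` = `StretchedTop.curl_zero_field`, `typeI_ancient_eq_zero_of_lamb_eq_zero` = `StretchedTop.typeI_ancient_eq_zero_of_lamb_eq_zero`, `lamb_smul` = `StretchedTop.lamb_smul`, `axialDefect` = `ColumnarTop.axialDefect`, `axialDefect_fderiv` = `ColumnarTop.axialDefect_fderiv`, `axialDefect_smul` = `ColumnarTop.axialDefect_smul`, `continuous_axialDefect` = `ColumnarTop.continuous_axialDefect`,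 `tendsto_physicalTime` = `ColumnarTop.tendsto_physicalTime`, `eventually_fast` = `ColumnarTop.eventually_fast`, `sqrt_timeLag` = `StretchedTop.sqrt_timeLag`, `closed_transfer` = `StretchedTop.closed_transfer`, `forall_of_forall_ne_zero` = `StretchedTop.forall_of_forall_ne_zero`, `sing_of_not_bounded` = `InviscidTop.sing_of_not_bounded`.
-/

-- the summit and its single problem share the name `NavierStokesRegularity` (D-0017 nested layout)
set_option linter.dupNamespace false

noncomputable section

open MeasureTheory Set Function Filter TopologicalSpace Metric
open scoped Topology NNReal ENNReal InnerProductSpace RealInnerProductSpace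

namespace Summit.NavierStokesRegularity.NavierStokesRegularity.Theorems.ScenarioCensus.EpsilonTop

open Literature.Analysis Literature.Analysis.FluidPDE
open Summit.NavierStokesRegularity.NavierStokesRegularity.Theorems

/-- `ℝ³`. -/
abbrev E3 := EuclideanSpace ℝ (Fin 3)

/-! ## §1 The dimensionless Type-I constant, ε-defects on the top, the rows, the floor, the residual -/

/-- **Subcritical (moving) speed level**: `Λ(t) √(T − t) → 0` as `t ↑ T`. -/
def IsSubcriticalLevel (T : ℝ) (Λ : ℝ → ℝ) : Prop :=
  Tendsto (fun t => Λ t * Real.sqrt (T - t)) (𝓝[<] T) (𝓝 0)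

/-- **Type-I blow-up with dimensionless constant `M`**: eventually `√(T − t) ‖u(t, x)‖ ≤ M √ν`. -/
def IsTypeIBlowupWith (M ν : ℝ) (u : ℝ → E3 → E3) (T : ℝ) : Prop :=
  ∀ᶠ t in 𝓝[<] T, ∀ x : E3, Real.sqrt (T - t) * ‖u t x‖ ≤ M * Real.sqrt ν

/-- **ε-columnar top** in the direction `e`: eventually `(T − t) ‖∂_e u(t, x)‖ ≤ ε` at every `Λ t`-fast point. -/
def HasDirectionDefectAt (T : ℝ) (Λ : ℝ → ℝ) (e : E3) (ε : ℝ) (u : ℝ → E3 → E3) : Prop :=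
  ∀ᶠ t in 𝓝[<] T, ∀ x : E3, Λ t < ‖u t x‖ → (T - t) * ‖fderiv ℝ (u t) x e‖ ≤ ε

/-- **ε-vorticity axis `e` on the top**: eventually `(T − t) ‖ω − ⟪ω, e⟫ e‖ ≤ ε` at every fast point. -/
def HasAxisDefectAt (T : ℝ) (Λ : ℝ → ℝ) (e : E3) (ε : ℝ) (u : ℝ → E3 → E3) : Prop :=
  ∀ᶠ t in 𝓝[<] T, ∀ x : E3, Λ t < ‖u t x‖ →
    (T - t) * ‖curl (u t) x - ⟪curl (u t) x, e⟫_ℝ • e‖ ≤ ε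

/-- **ε-sub-Type-I vorticity on the top**: eventually `(T − t) ‖ω(t, x)‖ ≤ ε` at every fast point. -/
def HasVorticityDefectAt (T : ℝ) (Λ : ℝ → ℝ) (ε : ℝ) (u : ℝ → E3 → E3) : Prop :=
  ∀ᶠ t in 𝓝[<] T, ∀ x : E3, Λ t < ‖u t x‖ → (T - t) * ‖curl (u t) x‖ ≤ ε

/-- **ε-Lamb top**: eventually `(T − t)^{3/2} ‖ω × u‖ ≤ ε √ν` at every fast point (`√ν` makes ε
dimensionless). -/
def HasLambDefectAt (T : ℝ) (Λ : ℝ → ℝ) (ν ε : ℝ) (u : ℝ → E3 → E3) : Prop :=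
  ∀ᶠ t in 𝓝[<] T, ∀ x : E3, Λ t < ‖u t x‖ →
    (T - t) * Real.sqrt (T - t) * ‖cross (curl (u t) x) (u t x)‖ ≤ ε * Real.sqrt ν

/-- Constant levels are subcritical. -/
theorem isSubcriticalLevel_const (T Λ : ℝ) : IsSubcriticalLevel T (fun _ => Λ) := by
  have h : Tendsto (fun t : ℝ => Λ * Real.sqrt (T - t)) (𝓝 T) (𝓝 (Λ * Real.sqrt (T - T))) :=
    ((continuous_const.sub continuous_id).sqrt.tendsto T).const_mul Λ
  rw [sub_self, Real.sqrt_zero, mul_zero] at h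
  exact h.mono_left nhdsWithin_le_nhds

-- `norm_sub_inner_smul_le`: the line restates the tree's `ColumnarTop.norm_sub_inner_smul_le`; taken BY NAME (gate lint dedup.landed).

/-- An ε-vorticity defect is an ε-axis defect about every unit vector. -/
theorem HasVorticityDefectAt.hasAxisDefectAt {T : ℝ} {Λ : ℝ → ℝ} {ε : ℝ} {u : ℝ → E3 → E3}
    (h : HasVorticityDefectAt T Λ ε u) {e : E3} (he : ‖e‖ = 1) : HasAxisDefectAt T Λ e ε u := by
  filter_upwards [h, self_mem_nhdsWithin] with t ht htT x hx
  have htT' : t < T := htT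
  exact (mul_le_mul_of_nonneg_left (ColumnarTop.norm_sub_inner_smul_le _ he) (sub_pos.2 htT').le).trans (ht x hx)

/-- Monotonicity of the defects in `ε`. -/
theorem HasDirectionDefectAt.mono {T : ℝ} {Λ : ℝ → ℝ} {e : E3} {ε ε' : ℝ} {u : ℝ → E3 → E3}
    (h : HasDirectionDefectAt T Λ e ε u) (hε : ε ≤ ε') : HasDirectionDefectAt T Λ e ε' u :=
  Filter.Eventually.mono h fun _ ht x hx => (ht x hx).trans hε

/-- Monotonicity of the axis defect in `ε`. -/
theorem HasAxisDefectAt.mono {T : ℝ} {Λ : ℝ → ℝ} {e : E3} {ε ε' : ℝ} {u : ℝ → E3 → E3}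
    (h : HasAxisDefectAt T Λ e ε u) (hε : ε ≤ ε') : HasAxisDefectAt T Λ e ε' u :=
  Filter.Eventually.mono h fun _ ht x hx => (ht x hx).trans hε

/-- Monotonicity of the vorticity defect in `ε`. -/
theorem HasVorticityDefectAt.mono {T : ℝ} {Λ : ℝ → ℝ} {ε ε' : ℝ} {u : ℝ → E3 → E3}
    (h : HasVorticityDefectAt T Λ ε u) (hε : ε ≤ ε') : HasVorticityDefectAt T Λ ε' u :=
  Filter.Eventually.mono h fun _ ht x hx => (ht x hx).trans hε

/-- Monotonicity of the Lamb defect in `ε`. -/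
theorem HasLambDefectAt.mono {T ν : ℝ} {Λ : ℝ → ℝ} {ε ε' : ℝ} {u : ℝ → E3 → E3}
    (h : HasLambDefectAt T Λ ν ε u) (hε : ε ≤ ε') : HasLambDefectAt T Λ ν ε' u :=
  Filter.Eventually.mono h fun _ ht x hx =>
    (ht x hx).trans (mul_le_mul_of_nonneg_right hε (Real.sqrt_nonneg ν))

/-- A dimensionless Type-I bound is a Type-I bound. -/
theorem IsTypeIBlowupWith.isTypeIBlowup {M ν T : ℝ} {u : ℝ → E3 → E3} (h : IsTypeIBlowupWith M ν u T) :
    IsTypeIBlowup u T := by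
  refine ⟨M * Real.sqrt ν, ?_⟩
  filter_upwards [h, self_mem_nhdsWithin] with t ht htT x
  have htT' : t < T := htT
  have hs : 0 < Real.sqrt (T - t) := Real.sqrt_pos.2 (sub_pos.2 htT')
  rw [le_div_iff₀ hs, mul_comm]
  exact ht x

/-- Every Type-I blow-up has a dimensionless constant (`M = C/√ν`). -/
theorem exists_isTypeIBlowupWith {ν T : ℝ} (hν : 0 < ν) {u : ℝ → E3 → E3} (h : IsTypeIBlowup u T) :
    ∃ M : ℝ, IsTypeIBlowupWith M ν u T := by
  obtain ⟨C, hC⟩ := h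
  refine ⟨C / Real.sqrt ν, ?_⟩
  have hsν : 0 < Real.sqrt ν := Real.sqrt_pos.2 hν
  filter_upwards [hC, self_mem_nhdsWithin] with t ht htT x
  have htT' : t < T := htT
  have hs : 0 < Real.sqrt (T - t) := Real.sqrt_pos.2 (sub_pos.2 htT')
  rw [div_mul_cancel₀ C hsν.ne']
  have h1 := ht x
  rw [le_div_iff₀ hs] at h1
  rw [mul_comm]
  exact h1

/-- **Criterion row F1qd** (Type I(`M`) · no symmetry · Clay class · ε(M)-COLUMNAR TOP ⇒ extension): for
every `M` ONE `ε > 0` such that the frame of `Row_F1` + `IsTypeIBlowupWith M ν u T` + a subcritical level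
and a unit vector `e` with `(T − t)‖∂_e u‖ ≤ ε` on the top ⇒ `HasSmoothExtensionPast`.  PROVED. -/
def Row_F1qd : Prop :=
  ∀ M : ℝ, ∃ ε : ℝ, 0 < ε ∧ ∀ (ν T : ℝ), 0 < ν → 0 < T →
    ∀ (u : ℝ → E3 → E3) (p : ℝ → E3 → ℝ),
    IsClassicalNSSolutionOn (Ico 0 T) ν 0 u p → IsLerayHopfOn T ν 0 (u 0) u →
    HasRapidSpatialDecay (u 0) → IsTypeIBlowupWith M ν u T →
    (∃ Λ : ℝ → ℝ, IsSubcriticalLevel T Λ ∧ ∃ e : E3, ‖e‖ = 1 ∧ HasDirectionDefectAt T Λ e ε u) →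
    HasSmoothExtensionPast ν 0 u T

/-- **Criterion row F1qa** (… ε(M)-VORTICITY AXIS on the top ⇒ extension).  PROVED. -/
def Row_F1qa : Prop :=
  ∀ M : ℝ, ∃ ε : ℝ, 0 < ε ∧ ∀ (ν T : ℝ), 0 < ν → 0 < T →
    ∀ (u : ℝ → E3 → E3) (p : ℝ → E3 → ℝ),
    IsClassicalNSSolutionOn (Ico 0 T) ν 0 u p → IsLerayHopfOn T ν 0 (u 0) u →
    HasRapidSpatialDecay (u 0) → IsTypeIBlowupWith M ν u T →
    (∃ Λ : ℝ → ℝ, IsSubcriticalLevel T Λ ∧ ∃ e : E3, ‖e‖ = 1 ∧ HasAxisDefectAt T Λ e ε u) →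
    HasSmoothExtensionPast ν 0 u T

/-- **Criterion row F1qw** (… ε(M)-SUB-TYPE-I VORTICITY on the top ⇒ extension).  PROVED. -/
def Row_F1qw : Prop :=
  ∀ M : ℝ, ∃ ε : ℝ, 0 < ε ∧ ∀ (ν T : ℝ), 0 < ν → 0 < T →
    ∀ (u : ℝ → E3 → E3) (p : ℝ → E3 → ℝ),
    IsClassicalNSSolutionOn (Ico 0 T) ν 0 u p → IsLerayHopfOn T ν 0 (u 0) u →
    HasRapidSpatialDecay (u 0) → IsTypeIBlowupWith M ν u T →
    (∃ Λ : ℝ → ℝ, IsSubcriticalLevel T Λ ∧ HasVorticityDefectAt T Λ ε u) →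
    HasSmoothExtensionPast ν 0 u T

/-- **Criterion row F1ql** (… ε(M)-LAMB TOP ⇒ extension).  PROVED. -/
def Row_F1ql : Prop :=
  ∀ M : ℝ, ∃ ε : ℝ, 0 < ε ∧ ∀ (ν T : ℝ), 0 < ν → 0 < T →
    ∀ (u : ℝ → E3 → E3) (p : ℝ → E3 → ℝ),
    IsClassicalNSSolutionOn (Ico 0 T) ν 0 u p → IsLerayHopfOn T ν 0 (u 0) u →
    HasRapidSpatialDecay (u 0) → IsTypeIBlowupWith M ν u T →
    (∃ Λ : ℝ → ℝ, IsSubcriticalLevel T Λ ∧ HasLambDefectAt T Λ ν ε u) →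
    HasSmoothExtensionPast ν 0 u T

/-- **Ancient row (ε-Liouville, columnar)**: ∀ M ∃ ε(M) > 0: `W ∈ 𝒦_M`, `e` unit,
`(−s)‖∂_e W(s, y)‖ ≤ ε` everywhere ⇒ `W ≡ 0`.  PROVED. -/
def Liouville_qd : Prop :=
  ∀ M : ℝ, ∃ ε : ℝ, 0 < ε ∧ ∀ e : E3, ‖e‖ = 1 → ∀ W : ℝ → E3 → E3, IsTypeIAncientMild M W →
    (∀ s < (0 : ℝ), ∀ y : E3, (-s) * ‖fderiv ℝ (W s) y e‖ ≤ ε) → ∀ s < (0 : ℝ), ∀ y : E3, W s y = 0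

/-- **Ancient row (ε-Liouville, vorticity axis)**.  PROVED. -/
def Liouville_qa : Prop :=
  ∀ M : ℝ, ∃ ε : ℝ, 0 < ε ∧ ∀ e : E3, ‖e‖ = 1 → ∀ W : ℝ → E3 → E3, IsTypeIAncientMild M W →
    (∀ s < (0 : ℝ), ∀ y : E3, (-s) * ‖curl (W s) y - ⟪curl (W s) y, e⟫_ℝ • e‖ ≤ ε) →
    ∀ s < (0 : ℝ), ∀ y : E3, W s y = 0

/-- **Ancient row (ε-Liouville, small Type-I vorticity)**.  PROVED. -/
def Liouville_qw : Prop :=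
  ∀ M : ℝ, ∃ ε : ℝ, 0 < ε ∧ ∀ W : ℝ → E3 → E3, IsTypeIAncientMild M W →
    (∀ s < (0 : ℝ), ∀ y : E3, (-s) * ‖curl (W s) y‖ ≤ ε) → ∀ s < (0 : ℝ), ∀ y : E3, W s y = 0

/-- **Ancient row (ε-Liouville, small Lamb vector)**.  PROVED. -/
def Liouville_ql : Prop :=
  ∀ M : ℝ, ∃ ε : ℝ, 0 < ε ∧ ∀ W : ℝ → E3 → E3, IsTypeIAncientMild M W →
    (∀ s < (0 : ℝ), ∀ y : E3, (-s) * Real.sqrt (-s) * ‖cross (curl (W s) y) (W s y)‖ ≤ ε) →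
    ∀ s < (0 : ℝ), ∀ y : E3, W s y = 0

/-- **QUANTITATIVELY THREE-DIMENSIONAL TOP** (structural floor, maximal frame): for every `M` one `ε(M) > 0`
such that a maximal Type-I(`M`) Clay blow-up has, on the top of EVERY subcritical level, none of the four
ε-defects.  PROVED (`quantitativelyThreeDTop_holds`). -/
def QuantitativelyThreeDTop : Prop :=
  ∀ M : ℝ, ∃ ε : ℝ, 0 < ε ∧ ∀ (ν T : ℝ), 0 < ν → 0 < T →
    ∀ (u : ℝ → E3 → E3) (p : ℝ → E3 → ℝ),
    IsMaximalSmoothSolution ν 0 u p T → IsLerayHopfOn T ν 0 (u 0) u →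
    HasRapidSpatialDecay (u 0) → IsTypeIBlowupWith M ν u T →
    ∀ Λ : ℝ → ℝ, IsSubcriticalLevel T Λ →
      (∀ e : E3, ‖e‖ = 1 → ¬ HasDirectionDefectAt T Λ e ε u ∧ ¬ HasAxisDefectAt T Λ e ε u) ∧
      ¬ HasVorticityDefectAt T Λ ε u ∧ ¬ HasLambDefectAt T Λ ν ε u

/-- **Residual** (maximal frame): for every `M` and every `ε > 0`, every maximal Type-I(`M`) Clay blow-up has
an ε-sub-Type-I-vorticity top at some subcritical level.  DECLARED ≡ row F1
(`vorticityDefectSlack_iff_rowF1`); no movement on `Row_F1` is claimed. -/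
@[conjecture] def VorticityDefectSlack : Prop :=
  ∀ (M ε : ℝ), 0 < ε → ∀ (ν T : ℝ), 0 < ν → 0 < T →
    ∀ (u : ℝ → E3 → E3) (p : ℝ → E3 → ℝ),
    IsMaximalSmoothSolution ν 0 u p T → IsLerayHopfOn T ν 0 (u 0) u →
    HasRapidSpatialDecay (u 0) → IsTypeIBlowupWith M ν u T →
    ∃ Λ : ℝ → ℝ, IsSubcriticalLevel T Λ ∧ HasVorticityDefectAt T Λ ε u

/-- The coordinate vector `e₀` is a unit vector. -/
theorem norm_single_zero_one : ‖(EuclideanSpace.single (0 : Fin 3) (1 : ℝ) : E3)‖ = 1 := by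
  simp

/-- F1qa contains F1qw (an ε-vorticity defect is an ε-axis defect about `e₀`). -/
theorem rowF1qw_of_rowF1qa (h : Row_F1qa) : Row_F1qw := by
  intro M
  obtain ⟨ε, hε, hrow⟩ := h M
  exact ⟨ε, hε, fun ν T hν hT u p hsol hLH hdec hTI ⟨Λ, hΛ, hw⟩ =>
    hrow ν T hν hT u p hsol hLH hdec hTI ⟨Λ, hΛ, _, norm_single_zero_one,
      hw.hasAxisDefectAt norm_single_zero_one⟩⟩

/-- **The split**: criterion + residual ⇒ row F1 (by cases on extendability; `M = C/√ν`). -/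
theorem rowF1_of (hD : Row_F1qw) (hR : VorticityDefectSlack) : ScenarioCensus.Row_F1 := by
  unfold ScenarioCensus.Row_F1
  intro ν T hν hT u p hsol hLH hdec hTI
  obtain ⟨M, hM⟩ := exists_isTypeIBlowupWith hν hTI
  obtain ⟨ε, hε, hrow⟩ := hD M
  by_contra hext
  exact hext (hrow ν T hν hT u p hsol hLH hdec hM (hR M ε hε ν T hν hT u p ⟨hsol, hext⟩ hLH hdec hM))

/-- The residual is a consequence of the row (vacuously: under `Row_F1` no maximal solution is Type I). -/
theorem vorticityDefectSlack_of_rowF1 (h : ScenarioCensus.Row_F1) : VorticityDefectSlack :=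
  fun _ _ _ ν T hν hT u p hmax hLH hdec hTI =>
    (hmax.2 (h ν T hν hT u p hmax.1 hLH hdec hTI.isTypeIBlowup)).elim

/-! ## §2 The `M`-normalised singular Type-I zoom package with gradients -/

/-- **The singular Type-I zoom package, `M`-normalised**: at a backward-singular final-time point `(T, x₀)`
of a Type-I(`M`) Clay solution there are positive constants `α, β, R` with `α R = β` and `α √ν = √β`,
positive scales `c_j → 0` and a NONTRIVIAL `W ∈ 𝒦_M` (class constant EXACTLY the dimensionless Type-I
constant) such that the zooms `(c_j α) u(T + c_j² β t, x₀ + c_j R y) → W(t, y)` and their gradients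
`(c_j α)(c_j R) ∇u(…) → ∇W(t, y)` pointwise on the open past.
(refs: AlbrittonBarker2019, §3; KochNadirashviliSereginSverak2009, Lemma 6.1) -/
theorem exists_singularZoom_package {ν T M : ℝ} (hν : 0 < ν) (hT : 0 < T)
    {u : ℝ → E3 → E3} {p : ℝ → E3 → ℝ}
    (hsol : IsClassicalNSSolutionOn (Ico 0 T) ν 0 u p) (hLH : IsLerayHopfOn T ν 0 (u 0) u)
    (hdec : HasRapidSpatialDecay (u 0)) (hMν : IsTypeIBlowupWith M ν u T) (x₀ : E3)
    (hsing : ∀ r : ℝ, 0 < r →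
      eLpNorm (uncurry u) ∞ (volume.restrict (parabolicCylinder r ((T : ℝ), x₀))) = ∞) :
    ∃ (α β R : ℝ) (c : ℕ → ℝ) (W : ℝ → E3 → E3),
      0 < α ∧ 0 < β ∧ 0 < R ∧ α * R = β ∧ α * Real.sqrt ν = Real.sqrt β ∧
      (∀ j, 0 < c j) ∧ Tendsto c atTop (𝓝 0) ∧
      IsTypeIAncientMild M W ∧
      (∀ t < 0, ∀ y : E3,
        Tendsto (fun j => (c j * α) • u (T + c j ^ 2 * β * t) (x₀ + (c j * R) • y)) atTop (𝓝 (W t y))) ∧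
      (∀ t < 0, ∀ y : E3,
        Tendsto (fun j => (c j * α * (c j * R)) • fderiv ℝ (u (T + c j ^ 2 * β * t)) (x₀ + (c j * R) • y))
          atTop (𝓝 (fderiv ℝ (W t) y))) ∧
      ∃ t < 0, ∃ y, W t y ≠ 0 := by
  -- ## (1) the Type-I(`M`) rate window, the Morrey bound and the unit zoom at `(T, x₀)`
  have hTI : IsTypeIBlowup u T := hMν.isTypeIBlowup
  obtain ⟨T₂, hT₂, hsub⟩ := (mem_nhdsLT_iff_exists_Ioo_subset).1 hMν
  set δ : ℝ := min (T - T₂) T with hδdef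
  have hδ : 0 < δ := lt_min (sub_pos.2 hT₂) hT
  have hδT : δ ≤ T := min_le_right _ _
  have hrate : ∀ t ∈ Ioo (T - δ) T, ∀ x, Real.sqrt (T - t) * ‖u t x‖ ≤ M * Real.sqrt ν := by
    intro t ht x
    have h1 : δ ≤ T - T₂ := min_le_left _ _
    have ht2 : T₂ < t := by linarith [ht.1]
    exact hsub ⟨ht2, ht.2⟩ x
  obtain ⟨r₀, M₀, T₁, hr₀, hT₁, hMor⟩ := morrey_of_typeI hν hT hsol hLH hTI
  obtain ⟨R, α, β, hR, hα, hβ, hβeq, hαeq, hβT, hball, hGv, htypeI⟩ :=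
    exists_zoom_typeIBound_lt_top_of_morrey hν hT hsol hLH hr₀ hT₁ hMor x₀
  have hαR : α * R = β := by
    rw [hαeq, hβeq]
    ring
  have hsν : 0 < Real.sqrt ν := Real.sqrt_pos.2 hν
  have hαν : α * Real.sqrt ν = Real.sqrt β := by
    rw [hαeq, hβeq, Real.sqrt_div (sq_nonneg R), Real.sqrt_sq hR.le, div_mul_eq_mul_div,
      div_eq_div_iff hν.ne' hsν.ne', mul_assoc, Real.mul_self_sqrt hν.le]
  set v : ℝ → E3 → E3 := α • stPull β R T x₀ u with hv
  set πv : ℝ → E3 → ℝ :=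
    α ^ 2 • stPull β R T x₀ (fun t x => p t x - (p t 0 - normalisedPressure (u t) 0)) with hπv
  set Gv : ℝ → E3 → E3 →L[ℝ] E3 :=
    (α * R) • stPull β R T x₀ (fun t x => fderiv ℝ (u t) x) with hGvdef
  set I₀ : ℝ≥0∞ := typeIBound (parabolicCylinder (1 / 2) (0 : ℝ × E3)) v πv Gv with hI₀
  have hI₀top : I₀ ≠ ⊤ := htypeI.ne
  -- ## (2) the scales `c k = 1/(k+4) ↓ 0` and the zoom sequence
  set c : ℕ → ℝ := fun k => 1 / ((k : ℝ) + 4) with hc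
  have hcpos : ∀ k, 0 < c k := fun k => by simp only [hc]; positivity
  have hc4 : ∀ k, c k ≤ 1 / 4 := fun k =>
    div_le_div_of_nonneg_left zero_le_one (by norm_num) (by linarith [(Nat.cast_nonneg k : (0 : ℝ) ≤ k)])
  have hc2 : ∀ k, c k ≤ 1 / 2 := fun k => (hc4 k).trans (by norm_num)
  have hclim : Tendsto c atTop (𝓝 0) :=
    tendsto_const_nhds.div_atTop (tendsto_atTop_add_const_right _ _ tendsto_natCast_atTop_atTop)
  set w : ℕ → ℝ → E3 → E3 :=
    fun k => (c k * α) • stPull (c k ^ 2 * β) (c k * R) T x₀ u with hw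
  set Aw : ℕ → ℝ := fun k => -(δ / (c k ^ 2 * β)) with hA
  have hAk : ∀ k, Aw k = -(δ / β * ((k : ℝ) + 4) ^ 2) := by
    intro k
    simp only [hA, hc]
    field_simp
  have hAlim : Tendsto Aw atTop atBot := by
    have h1 : Tendsto (fun k : ℕ => ((k : ℝ) + 4) ^ 2) atTop atTop :=
      (tendsto_pow_atTop two_ne_zero).comp
        (tendsto_atTop_add_const_right _ _ tendsto_natCast_atTop_atTop)
    have h2 : Tendsto (fun k : ℕ => δ / β * ((k : ℝ) + 4) ^ 2) atTop atTop :=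
      h1.const_mul_atTop (by positivity)
    refine (tendsto_neg_atTop_atBot.comp h2).congr fun k => ?_
    rw [hAk k]
    rfl
  -- ## (3) per-scale facts
  have hcW : ∀ k, ContinuousOn (uncurry (w k)) (Ioo (Aw k) 0 ×ˢ univ) := fun k =>
    zoom_continuousOn hν hsol hR hαeq hβeq (hcpos k) hδT
  have hdivW : ∀ k, ∀ t ∈ Ioo (Aw k) 0, IsWeaklyDivFree (w k t) := fun k t ht =>
    zoom_isWeaklyDivFree hν hsol hR hαeq hβeq (hcpos k) hδT ht
  have hmildW : ∀ k, ∀ s t : ℝ, Aw k < s → s < t → t < 0 → ∀ y,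
      w k t y = UnboundedOperators.heatExtension (w k s) (t - s) y -
        oseenDuhamel 1 s (w k) (w k) t y := fun k s t hs hst ht y =>
    zoom_oseen hν hT hsol hLH hdec hR hαeq hβeq (hcpos k) hδT hs hst ht y
  set C₁ : ℝ := α * (M * Real.sqrt ν) / Real.sqrt β with hC₁
  have hC₁M : C₁ = M := by
    rw [hC₁, ← hαν]
    field_simp
  have hIW : ∀ k, ∀ t ∈ Ioo (Aw k) 0, ∀ y, ‖w k t y‖ ≤ C₁ / Real.sqrt (-t) := fun k t ht y =>
    zoom_norm_le hR hαeq hβeq hν (hcpos k) hδT hrate ht y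
  -- ## (4) extraction of the `C¹_loc` limit `W ∈ 𝒦_{C₁} = 𝒦_M`
  obtain ⟨φ, hφ, W, hWclass, hpt, hgrad, -, -⟩ :=
    exists_tendsto_of_typeI_seq_Ioo C₁ hAlim hcW hdivW hmildW hIW
  rw [hC₁M] at hWclass
  have hφt : Tendsto φ atTop atTop := hφ.tendsto_atTop
  have hcφ : Tendsto (fun j => c (φ j)) atTop (𝓝 0) := hclim.comp hφt
  -- ## (5) `W` is unbounded at the origin
  have hsingW : ∀ r > 0, ∀ M' : ℝ, ∃ t ∈ Ioo (-(r ^ 2)) (0 : ℝ),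
      ∃ x ∈ ball (0 : E3) r, M' < ‖W t x‖ :=
    zoomSeq_unbounded_at_origin (πv := πv) hsol hR hα hβ hβT hsing hball hGv hI₀top
      (fun j => hcpos (φ j)) (fun j => hc2 (φ j)) fun z hz =>
        hpt z.1 ((SuitableCompactness.mem_parabolicCylinder_zero.1 hz).1.2) z.2
  have hwu : ∀ (j : ℕ) (t : ℝ) (y : E3),
      w (φ j) t y = (c (φ j) * α) • u (T + c (φ j) ^ 2 * β * t) (x₀ + (c (φ j) * R) • y) :=
    fun j t y => by simp only [hw, smul_stPull_apply]
  have hwD : ∀ (j : ℕ) (t : ℝ) (y : E3),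
      fderiv ℝ (w (φ j) t) y = (c (φ j) * α * (c (φ j) * R)) •
        fderiv ℝ (u (T + c (φ j) ^ 2 * β * t)) (x₀ + (c (φ j) * R) • y) := by
    intro j t y
    have e1 : w (φ j) t = (c (φ j) * α) • stPull (c (φ j) ^ 2 * β) (c (φ j) * R) T x₀ u t := by
      simp only [hw, Pi.smul_apply]
    rw [e1, fderiv_const_smul_field, Pi.smul_apply, fderiv_stPull, smul_smul]
  -- ## (6) package
  obtain ⟨ts, hts, xs, -, hM'⟩ := hsingW 1 one_pos 0
  have hne : W ts xs ≠ 0 := by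
    intro h0; rw [h0, norm_zero] at hM'; exact lt_irrefl _ hM'
  exact ⟨α, β, R, fun j => c (φ j), W, hα, hβ, hR, hαR, hαν, fun j => hcpos _, hcφ, hWclass,
    fun t ht y => (hpt t ht y).congr fun j => hwu j t y,
    fun t ht y => (hgrad t ht y).congr fun j => hwD j t y, ts, hts.2, xs, hne⟩

end Summit.NavierStokesRegularity.NavierStokesRegularity.Theorems.ScenarioCensus.EpsilonTop

end
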